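import Summits.ResolutionOfSingularities.ResolutionOfSingularities.Theorems.HilbertSamuelEliminationSigmaMaxModificationsCorridor3WLadderIsoInsepE2Lift
import Summits.ResolutionOfSingularities.ResolutionOfSingularities.Theorems.HilbertSamuelEliminationSigmaMaxModificationsCorridor3WLadderIsoInsepDoublePointPropagates
import Summits.ResolutionOfSingularities.ResolutionOfSingularities.Theorems.HilbertSamuelEliminationSigmaMaxModificationsCorridor3TameValueHypersurfaceCut
import Summits.ResolutionOfSingularities.ResolutionOfSingularities.Theorems.HilbertSamuelEliminationSigmaMaxModificationsCorridor3QuadricGap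
import Literature.AlgebraicGeometry.Resolution.RegularLocalRingsProofs
import HarnessLib

/-!
# [OURS · L1 W4.2] E2 chart calculus, brick 4: FROM THE ROW DATA TO THE ALGEBRAIC E2 SHAPE — a formal double point of embedding dimension
# four with `e = 2`, `ē = 3` on a scheme over a field of characteristic two has a hypersurface presentation `σ : R ↠ 𝒪_{X,x}`,
# `R` regular local of embedding dimension `4`, `ker σ = (h)`, `h ≡ ĉ(x² + λ̂y²) (mod 𝔪³)`, `λ̄ ∉ κ²`
# (crux chain w42, cell k2 `T3insep` = `stub_isoInsepTower`; `--supports stmt-ResolutionOfSingularities-19249`)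

OURS (cell res-hironaka, slot W4.2, seat res-D-pv-042; OWN OBJECT TUO 15:58Z); NOT a statement of [Hironaka2017] nor of
[CossartJannsenSaito2020] / [CossartPiltant2008]. AI-drafted, weaker than expert review. PROOF file, def-free, fact-free.

* `exists_e2Shape_of_isFormalDoublePointAt` — `X` locally of finite type over a field `k` of characteristic `2`, `x` a formal double point
  (`IdeasL1C6.IsFormalDoublePointAt X x`) with `Scheme.dirDim X x = 2` and `Scheme.geomDirDim X x = 3` (the data of `IdeasL1C6.IsE2Stage`):
  there are a regular local ring `R` of embedding dimension `4` with regular parameters `y`, a surjection `σ : R ↠ 𝒪_{X,x}` with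
  `ker σ = (h)`, `h ∈ 𝔪² ∖ 𝔪³`, and `ŝ, t̂, ĉ, λ̂` as in brick 3: `h − ĉ·((Σ ŝᵢyᵢ)² + λ̂(Σ t̂ᵢyᵢ)²) ∈ 𝔪³`.
  Route: `isFormalDoublePointAt_iff_hilbertFun_eq` (p541968) ⇒ `H⁽⁰⁾(𝒪) = hypersurfaceHFe 4 2`; `TameWild.exists_regular_presentation_stalk`
  + the tame line's cut `Helpers.exists_regular_quotient_of_hilbertFun_eq_hypersurfaceHFe` ⇒ `𝒪 ≅ (S/J)/(ḡ)`, `S/J` regular of dimension `4`,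
  `ord ḡ = 2`; then brick 3 `exists_e2Shape_of_dirDim` (p548123).
-/

noncomputable section

set_option linter.dupNamespace false

open scoped Classical
open CategoryTheory AlgebraicGeometry TopologicalSpace IsLocalRing MvPolynomial Module
open Literature.RingTheory.MvPolynomial Literature.RingTheory.HilbertSamuel Literature.AlgebraicGeometry.Resolution
open Summit.ResolutionOfSingularities.ResolutionOfSingularities.Theorems.SigmaMaxModificationsCorridor3
open Summit.ResolutionOfSingularities.ResolutionOfSingularities.Theorems.SigmaMaxModificationsCorridor3.Helpers
  (hypersurfaceHFe exists_regular_quotient_of_hilbertFun_eq_hypersurfaceHFe)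

namespace Summit.ResolutionOfSingularities.ResolutionOfSingularities.Cruxes.SigmaMaxModifications.IdeasL1C6

/-- **FROM THE ROW DATA TO THE ALGEBRAIC E2 SHAPE.** For `X` locally of finite type over a field `k` of characteristic two and a point `x`
with `IsFormalDoublePointAt X x`, `Scheme.dirDim X x = 2`, `Scheme.geomDirDim X x = 3`: a hypersurface presentation `σ : R ↠ 𝒪_{X,x}` from a
regular local ring of embedding dimension `4` with regular parameters `y`, `ker σ = (h)`, `h ∈ 𝔪² ∖ 𝔪³`, and the E2 shape
`h − ĉ·((Σ ŝᵢyᵢ)² + λ̂(Σ t̂ᵢyᵢ)²) ∈ 𝔪³` with `ŝ, t̂` residually independent, `ĉ` a unit, `λ̄` not a square.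
[OURS · L1 W4.2 · k2 · E2 chart calculus, brick 4] [folklore] -/
theorem exists_e2Shape_of_isFormalDoublePointAt {k : Type} [Field k] [CharP k 2] {X : Scheme.{0}} (f : X ⟶ Spec (.of k))
    [LocallyOfFiniteType f] [IsLocallyNoetherian X] (x : X) (hdp : IsFormalDoublePointAt X x) (he : Scheme.dirDim X x = 2)
    (hgeom : Scheme.geomDirDim X x = 3) :
    ∃ (R : Type) (_ : CommRing R) (_ : IsRegularLocalRing R) (y : Fin 4 → R) (σ : R →+* X.presheaf.stalk x) (h : R)
      (s t : Fin 4 → R) (c lam : R),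
      (maximalIdeal R).spanFinrank = 4 ∧ Ideal.span (Set.range y) = maximalIdeal R ∧ Function.Surjective σ ∧
      RingHom.ker σ = Ideal.span {h} ∧ h ∈ maximalIdeal R ^ 2 ∧ h ∉ maximalIdeal R ^ 3 ∧
      (∀ a b : ResidueField R, (∀ i, a * residue R (s i) + b * residue R (t i) = 0) → a = 0 ∧ b = 0) ∧
      c ∉ maximalIdeal R ∧ (∀ u : R, u ^ 2 - lam ∉ maximalIdeal R) ∧
      h - c * ((∑ i, s i * y i) ^ 2 + lam * (∑ i, t i * y i) ^ 2) ∈ maximalIdeal R ^ 3 := by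
  set A := X.presheaf.stalk x with hA
  -- the Hilbert function of a formal double point
  have hH : hilbertFun A = hypersurfaceHFe 4 2 := (isFormalDoublePointAt_iff_hilbertFun_eq f x).mp hdp
  -- a regular presentation, cut down to embedding dimension `4`
  obtain ⟨S, _, _, σ₀, hσ₀⟩ := TameWild.exists_regular_presentation_stalk f x
  obtain ⟨J, g, hJle, hRreg, hdimR, hker₀, hg2, hg3⟩ :=
    exists_regular_quotient_of_hilbertFun_eq_hypersurfaceHFe σ₀ hσ₀ (e := 4) (m := 2) (by norm_num) le_rfl hH
  haveI := hRreg
  -- the induced presentation `σ : S/J ↠ A` with kernel `(ḡ)`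
  have hJ0 : ∀ a ∈ J, σ₀ a = 0 := fun a ha => hJle ha
  let σ : S ⧸ J →+* A := Ideal.Quotient.lift J σ₀ hJ0
  have hσ : Function.Surjective σ := Ideal.Quotient.lift_surjective_of_surjective J hJ0 hσ₀
  have hker : RingHom.ker σ = Ideal.span {Ideal.Quotient.mk J g} := by
    rw [Ideal.ker_quotient_lift, hker₀, Ideal.map_sup, Ideal.map_quotient_self, bot_sup_eq, Ideal.map_span, Set.image_singleton]
  -- embedding dimension and regular parameters of `S/J`
  have h4 : (maximalIdeal (S ⧸ J)).spanFinrank = 4 := by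
    have h := IsRegularLocalRing.spanFinrank_maximalIdeal (R := S ⧸ J)
    rw [hdimR] at h
    exact_mod_cast h
  obtain ⟨y, hy⟩ := exists_span_range_eq_maximalIdeal (S ⧸ J) h4.le
  -- `ḡ ∈ 𝔪² ∖ 𝔪³`
  have hmax : maximalIdeal (S ⧸ J) = (maximalIdeal S).map (Ideal.Quotient.mk J) := by
    haveI : Nontrivial (S ⧸ J) := inferInstance
    exact maximalIdeal_quotient_eq_map J
  have hh2 : Ideal.Quotient.mk J g ∈ maximalIdeal (S ⧸ J) ^ 2 := by
    rw [hmax, ← Ideal.map_pow]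
    exact Ideal.mem_map_of_mem _ hg2
  have hh3 : Ideal.Quotient.mk J g ∉ maximalIdeal (S ⧸ J) ^ (2 + 1) := by
    rw [hmax, ← Ideal.map_pow, Ideal.mem_quotient_iff_mem_sup]
    exact hg3
  -- residue characteristic two
  obtain ⟨φ⟩ := exists_ringHom_field_stalk f x
  haveI : CharP (ResidueField A) 2 := charP_of_injective_ringHom ((residue A).comp φ).injective 2
  -- the directrix data of the stalk
  have he' : dirDim A + 2 = 4 := by
    have : Scheme.dirDim X x = dirDim A := rfl
    omega
  have hgeom' : geomDirDim A + 1 = 4 := by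
    have : Scheme.geomDirDim X x = geomDirDim A := rfl
    omega
  obtain ⟨s, t, c, lam, hst, hc, hlam, hshape⟩ :=
    exists_e2Shape_of_dirDim h4 y hy σ hσ hker hh2 hh3 he' hgeom'
  exact ⟨S ⧸ J, inferInstance, hRreg, y, σ, Ideal.Quotient.mk J g, s, t, c, lam, h4, hy, hσ, hker, hh2, hh3, hst, hc, hlam, hshape⟩

end Summit.ResolutionOfSingularities.ResolutionOfSingularities.Cruxes.SigmaMaxModifications.IdeasL1C6

end
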